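import Literature.AlgebraicGeometry.CossartJannsenSaito2020.BlowupTowerLocalize
import HarnessLib

/-!
# CJS LNM 2270, Def. 6.34 (iii) / Def. 6.38 (iv) «`π_q` induces an isomorphism `C_q ⥲ C_{q−1}`» read on the
# LOCALISED tower: the isomorphism of centres is transported by base change — PROOFS (companion of
# `BlowupTowerLocalize.lean`)

Source: V. Cossart, U. Jannsen, S. Saito, *Desingularization: Invariants and Strategy*, LNM **2270** (2020)
[`CossartJannsenSaito2020`]: Def. 6.34 (iii) / Def. 6.38 (iv) «`X_q = Bℓ_{C_{q−1}}(X_{q−1})` and `π_q : C_q ⥲ C_{q−1}` is an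
isomorphism», typed in the tree as `InducesIsoOn (T.π j) (C_{j+1}) (C_j)` (`KeyTheorems.lean`: an isomorphism of the
reduced closed subschemes commuting with `π`), and p. 107 «the claims … depend only on the localization
`X_x = Spec(𝒪_{X,x})`». For a base change of the tower along a flat preimmersion (`BlowupTower.baseChange`, comparison
maps `ι_n`, cartesian squares `ι_{j+1} ≫ π_j = π'_j ≫ ι_j`) we PROVE:

* `exists_subschemeIso_comap_of_isPullback` — general: for a CARTESIAN square `ι' ≫ π = π' ≫ ι` and ideal sheaves `J`
  on `X`, `J'` on `X'`, an isomorphism `V(J') ≅ V(J)` over `π` pulls back to an isomorphism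
  `V(J'·𝒪_{S'}) ≅ V(J·𝒪_S)` over `π'` (Mathlib `comapIso` + the universal property of pullbacks);
* `BlowupTower.inducesIsoOn_baseChange` — **«`C_{j+1} ⥲ C_j`» transfers to the base-changed tower**
  (reduced centres: `comap_vanishingIdeal_eq_of_flat_of_isPreimmersion`), `BlowupTower.inducesIsoOn_localize`.

With `BlowupTowerLocalizeUnit.lean` this removes the `iso` hypothesis there whenever it is known on the global tower.
Nothing about the Key Theorems is asserted.

## References

* V. Cossart, U. Jannsen, S. Saito, LNM 2270 (2020), Def. 6.34 (iii), Def. 6.38 (iv), p. 107. [CossartJannsenSaito2020]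
* U. Görtz, T. Wedhorn, *Algebraic Geometry I*, Prop. 13.91 (2) (base change). [GortzWedhorn2020]
-/

noncomputable section

open CategoryTheory CategoryTheory.Limits AlgebraicGeometry TopologicalSpace
open Literature.AlgebraicGeometry.Resolution
open Scheme.IdealSheafData

namespace Literature.AlgebraicGeometry.CossartJannsenSaito2020

universe u

/-! ## Isomorphisms of closed subschemes over a morphism pull back along cartesian squares -/

/-- **An isomorphism of closed subschemes `V(J') ≅ V(J)` over `π : X' ⟶ X` pulls back, along a cartesian square
`ι' ≫ π = π' ≫ ι`, to an isomorphism `V(J'·𝒪_{S'}) ≅ V(J·𝒪_S)` over `π'`** (`V(J·𝒪_S) ≅ V(J) ×_X S`, Mathlib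
`comapIso`, and the universal property of the fibre products). [cite: GortzWedhorn2020, Prop. 13.91 (2)] -/
theorem exists_subschemeIso_comap_of_isPullback {X' X S' S : Scheme.{u}} {π : X' ⟶ X} {π' : S' ⟶ S}
    {ι' : S' ⟶ X'} {ι : S ⟶ X} (H : IsPullback ι' π' π ι) (J : X.IdealSheafData) (J' : X'.IdealSheafData)
    (e : J'.subscheme ≅ J.subscheme) (he : e.hom ≫ J.subschemeι = J'.subschemeι ≫ π) :
    ∃ e' : (J'.comap ι').subscheme ≅ (J.comap ι).subscheme,
      e'.hom ≫ (J.comap ι).subschemeι = (J'.comap ι').subschemeι ≫ π' := by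
  -- the fibre products `A = S ×_X V(J)`, `A' = S' ×_{X'} V(J')`
  set i := J.subschemeι with hi
  set i' := J'.subschemeι with hi'
  have hinv : e.inv ≫ i' ≫ π = i := by
    rw [← he, e.inv_hom_id_assoc]
  -- `A' ⟶ A`
  let φ : pullback ι' i' ⟶ pullback ι i :=
    pullback.lift (pullback.fst ι' i' ≫ π') (pullback.snd ι' i' ≫ e.hom)
      (by rw [Category.assoc, ← H.w, ← Category.assoc, pullback.condition, Category.assoc, Category.assoc, he])
  -- `A ⟶ S'` through the cartesian square, then `A ⟶ A'`
  let τ : pullback ι i ⟶ S' :=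
    H.lift (pullback.snd ι i ≫ e.inv ≫ i') (pullback.fst ι i)
      (by rw [Category.assoc, Category.assoc, hinv, pullback.condition])
  have hτ1 : τ ≫ ι' = pullback.snd ι i ≫ e.inv ≫ i' := H.lift_fst _ _ _
  have hτ2 : τ ≫ π' = pullback.fst ι i := H.lift_snd _ _ _
  let ψ : pullback ι i ⟶ pullback ι' i' :=
    pullback.lift τ (pullback.snd ι i ≫ e.inv) (by rw [hτ1, Category.assoc])
  have hφψ : φ ≫ ψ = 𝟙 _ := by
    apply pullback.hom_ext
    · rw [Category.assoc, pullback.lift_fst, Category.id_comp]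
      apply H.hom_ext
      · rw [Category.assoc, hτ1, pullback.lift_snd_assoc, Category.assoc, e.hom_inv_id_assoc, pullback.condition]
      · rw [Category.assoc, hτ2, pullback.lift_fst]
    · rw [Category.assoc, pullback.lift_snd, pullback.lift_snd_assoc, Category.assoc, e.hom_inv_id,
        Category.comp_id, Category.id_comp]
  have hψφ : ψ ≫ φ = 𝟙 _ := by
    apply pullback.hom_ext
    · rw [Category.assoc, pullback.lift_fst, pullback.lift_fst_assoc, hτ2, Category.id_comp]
    · rw [Category.assoc, pullback.lift_snd, pullback.lift_snd_assoc, Category.assoc, e.inv_hom_id,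
        Category.comp_id, Category.id_comp]
  let isoA : pullback ι' i' ≅ pullback ι i := ⟨φ, ψ, hφψ, hψφ⟩
  refine ⟨J'.comapIso ι' ≪≫ isoA ≪≫ (J.comapIso ι).symm, ?_⟩
  rw [Iso.trans_hom, Iso.trans_hom, Iso.symm_hom, Category.assoc, Category.assoc, comapIso_inv_subschemeι]
  show (J'.comapIso ι').hom ≫ φ ≫ pullback.fst ι i = (J'.comap ι').subschemeι ≫ π'
  rw [pullback.lift_fst, ← Category.assoc, comapIso_hom_fst]

/-! ## «`C_{j+1} ⥲ C_j`» on the base-changed tower -/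

namespace BlowupTower

variable (T : BlowupTower.{u}) {S₀ : Scheme.{u}} (ι₀ : S₀ ⟶ T.X 0) [Flat ι₀] [IsPreimmersion ι₀]
  [IsLocallyNoetherian S₀]

/-- **Def. 6.34 (iii) / Def. 6.38 (iv) transfer to the base-changed tower**: if `π_{j+1}` induces an isomorphism
`C_{j+1} ⥲ C_j` of the reduced centres of `T`, then `π'_{j+1}` induces an isomorphism `ι_{j+1}⁻¹C_{j+1} ⥲ ι_j⁻¹C_j` of the
(reduced) centres of `T.baseChange ι₀`. [cite: CossartJannsenSaito2020, Def. 6.38 (iv), p. 107] -/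
theorem inducesIsoOn_baseChange (j : ℕ)
    (h : InducesIsoOn (T.π j) (T.C (j + 1)) (T.isClosed_C (j + 1)) (T.C j) (T.isClosed_C j)) :
    InducesIsoOn ((T.baseChange ι₀).π j) ((T.baseChange ι₀).C (j + 1)) ((T.baseChange ι₀).isClosed_C (j + 1))
      ((T.baseChange ι₀).C j) ((T.baseChange ι₀).isClosed_C j) := by
  haveI := T.flat_bcι ι₀ j
  haveI := T.isPreimmersion_bcι ι₀ j
  haveI := T.flat_bcι ι₀ (j + 1)
  haveI := T.isPreimmersion_bcι ι₀ (j + 1)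
  obtain ⟨e, he⟩ := h
  have hJ : vanishingIdeal ⟨(T.baseChange ι₀).C j, (T.baseChange ι₀).isClosed_C j⟩ =
      (vanishingIdeal ⟨T.C j, T.isClosed_C j⟩).comap (T.bcι ι₀ j) :=
    (comap_vanishingIdeal_eq_of_flat_of_isPreimmersion (T.bcι ι₀ j) ⟨T.C j, T.isClosed_C j⟩).symm
  have hJ' : vanishingIdeal ⟨(T.baseChange ι₀).C (j + 1), (T.baseChange ι₀).isClosed_C (j + 1)⟩ =
      (vanishingIdeal ⟨T.C (j + 1), T.isClosed_C (j + 1)⟩).comap (T.bcι ι₀ (j + 1)) :=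
    (comap_vanishingIdeal_eq_of_flat_of_isPreimmersion (T.bcι ι₀ (j + 1)) ⟨T.C (j + 1), T.isClosed_C (j + 1)⟩).symm
  unfold InducesIsoOn
  rw [hJ, hJ']
  exact exists_subschemeIso_comap_of_isPullback (T.bc_isPullback ι₀ j) _ _ e he

/-- The localised form (`T.localize x = T ×_{X_0} Spec 𝒪_{X_0,x}`). [cite: CossartJannsenSaito2020, Def. 6.38 (iv), p. 107] -/
theorem inducesIsoOn_localize (x : T.X 0) (j : ℕ)
    (h : InducesIsoOn (T.π j) (T.C (j + 1)) (T.isClosed_C (j + 1)) (T.C j) (T.isClosed_C j)) :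
    InducesIsoOn ((T.localize x).π j) ((T.localize x).C (j + 1)) ((T.localize x).isClosed_C (j + 1))
      ((T.localize x).C j) ((T.localize x).isClosed_C j) := by
  haveI : IsLocallyNoetherian (T.X 0) := T.ln 0
  haveI := flat_fromSpecStalk (T.X 0) x
  exact T.inducesIsoOn_baseChange ((T.X 0).fromSpecStalk x) j h

end BlowupTower

end Literature.AlgebraicGeometry.CossartJannsenSaito2020

end
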